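import Literature.Topology.FourManifolds.ProjectiveTowers
import Literature.Topology.FourManifolds.HomotopyBallSliceProofs
import Literature.Topology.FourManifolds.HomotopyBallSliceSphereProofs
import Literature.Topology.FourManifolds.OrientedConnectedSumExistence
import Literature.Topology.FourManifolds.ConnectedSumUniquenessProofs
import Literature.Topology.FourManifolds.InteriorDiscs
import Literature.Topology.FourManifolds.SmoothOrientationSphereProofs
import Literature.Topology.FourManifolds.SliceGenusMirrorProofs
import Literature.Topology.FourManifolds.SliceGenusEqZeroIffProofs
import Literature.Topology.FourManifolds.SliceRibbonIsotopyProofs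
import Literature.Topology.FourManifolds.RasmussenMirrorProofs
import Literature.Barriers.SmoothPoincare4.GluckTwistsDissolveRasmussenProofs
import Literature.AlgebraicTopology.SingularHomology.ExcisionMayerVietorisProofs
import Literature.AlgebraicTopology.SingularHomology.UniverseTransportIso
import HarnessLib

/-!
# MMSW 2023, Cor. 1.9 for knots (`Knot.rasmussen_nonpos_of_isTowerSlice`): what it contains, and its chirality

Sibling proof file of `Literature/Topology/FourManifolds/ProjectiveTowers.lean` for its named fact
`Literature.Topology.FourManifolds.Knot.rasmussen_nonpos_of_isTowerSlice` — C. Manolescu, M. Marengon,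
S. Sarkar, M. Willis, *A generalization of Rasmussen's invariant, with applications to surfaces in some
four-manifolds*, Duke Math. J. 172 (2023) 231–311 (arXiv:1910.08195), **Cor. 1.9 (= Cor. 6.12)**, the
adjunction inequality `s(L) ≤ 1 - χ(Σ)` for null-homologous surfaces in `(#ᵗℂℙ²bar) ∖ B⁴`, knot-and-disc
case (Cor. 6.13 with `|L| = 1`: `K` H-slice in `#ᵗℂℙ²bar` ⇒ `s(K) ≤ 0`), in the tree's tower-slice form
(`Knot.IsTowerSlice`: for SOME orientation `o` of `ℂℙ²`, every knot tower-slice over `o` has `s ≤ 0`).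
Everything here is **proved**; no definition and no named fact is introduced (D-0026). The fact itself is
NOT discharged: its printed proof (proof of Thm. 6.10, p. 19 of arXiv v3: make the disc transverse to the
`t` projective lines, `ℂℙ²bar ∖ ν(ℂℙ¹) ≅ B⁴`, the boundary pattern is the Hopf-fibre link `F_p(1)`, tube the
spheres together to get a cobordism in `I × S³` from `K` to `K ⊔ F_{p₁}(1) ⊔ ⋯ ⊔ F_{pₜ}(1)`; then Thm. 1.5
— the Lee-homology cobordism inequality of Beliakova–Wehrli / Rasmussen §4 —, Prop. 3.8
(`s(L ⊔ L') = s(L) + s(L') - 1`) and Thm. 1.7 (`s(F_p(1)) = 1 - 2p`, Hochschild homology)) lives on the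
`s`-invariant of LINKS and on maps induced on Lee homology by link cobordisms, and the tree's
`GaussDiagram` / `KhComplex` / `LeeRasmussen` layer is knots-only and has no cobordism maps — the same gap
that keeps Rasmussen's `Literature.Topology.FourManifolds.eq_zero_of_isSmoothlySlice` (Rasmussen 2010, Thm. 1)
a named fact (`RasmussenSliceProofs.lean`, `RasmussenSliceGenusProofs.lean`).

## What is proved here

* `det_reflectLastCLM` — the coordinate reflection `ρ = reflectLastCLM n` of `ℝⁿ⁺¹` has determinant `-1`.
* `Knot.IsTowerSlice.mirror_neg`, `Knot.isTowerSlice_mirror_neg_iff` — **chirality**: `K` is tower-slice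
  over `o` iff `K.mirror` is tower-slice over `-o` (same tower with the opposite orientation,
  `IsProjectiveTower.neg`; same disc; reflected ball chart `e ∘ ρ`, which is orientation preserving
  towards `-oP` because `det ρ = -1`, `isOrientationReversing_disc_comp_linear_of_det_neg`). This is the
  tree form of MMSW Remark 6.6, *"`L` is strongly H-slice in `ℂℙ²bar` if and only if `L̄` is strongly
  slice in `ℂℙ²`"*. (The summit side proves the same flip from its own stubs in
  `Summits/SmoothPoincare4/…/ZeroSurgeryExoticZseSVanishesOnPairsEmbedReduction.lean`, under the name
  `Knot.IsTowerSlice.mirror`; this is the Literature-side, stub-free version.)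
* `Knot.IsSliceDiscIn.comp_radialExtension_symm`, `Knot.isOrientationPreserving_comp_radialExtension_symm`,
  `Knot.IsTowerSlice.of_isIsotopic`, `Knot.isTowerSlice_congr` — **tower-sliceness is a property of the
  knot type**: an ambient isotopy `K ≅ K'` of `S³` is realised by a diffeotopy `D`
  (`AmbientIsotopy.exists_diffeotopy_toFun_eq_invFun_eq`), whose inverse radial extension `Ψ` to `ℝ⁴`
  (`RadialExtension.lean`, Cerf 1968) reparametrises the ball chart: `e ∘ Ψ` is again a smooth
  embedding with the same closed-ball image, bounds the same disc along `K'`, and is still orientation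
  preserving (it agrees with `e` near `0`; a disc preserves or reverses orientation).
* `Knot.rasmussen_nonpos_of_isTowerSlice_iff_diagram`, `Knot.rasmussen_nonpos_of_isTowerSlice_of_diagram`
  — hence the **diagram-level form**: the fact is equivalent to "for SOME `o`, every knot `K` tower-slice
  over `o` and every Gauss diagram `D` of `K` itself (`Knot.HasGaussDiagram K D`) have
  `D.rasmussenInvariant ≤ 0`" — the existential over isotopic representatives hidden in
  `Knot.HasRasmussenInvariant` is gone; this is the interface the missing link-level Lee-homology layer
  (MMSW Thm. 1.5 / Prop. 3.8 / Thm. 1.7 and the movie of the cobordism of the proof of Thm. 6.10) has to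
  meet.
* `Knot.IsSmoothlySlice.isTowerSlice` — **non-vacuity / height `0`**: a smoothly slice knot is tower-slice
  over EVERY orientation `o` of `ℂℙ²`, at height `0`: push the slice disc into `S⁴ ∖ c⁻¹(B̊⁴)`
  (`Knot.IsSliceDisc.isSliceDiscIn_sphere`), orient `S⁴` so that the round ball chart `c⁻¹` is orientation
  preserving (`exists_smoothOrientation_sphere`, `isOrientationPreserving_or_isOrientationReversing_disc`),
  and take `U = S⁴`, `H₂(S⁴; ℤ) = 0` (`isZero_singularHomology_sphere_holds`,
  `isZero_singularHomologyZ_two_sphere_four_top`).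
* `Knot.IsSliceDiscIn.isSmoothlySlice_of_diffeomorph_sphere`,
  `Knot.IsSliceDiscIn.isSmoothlySlice_of_isProjectiveTower_zero` — conversely, **tower-slice data of height
  `0` make the knot smoothly slice** (Palais: `palais_ballComplement_sphere_four_holds`, then
  `IsSliceDiscIn.exists_isProperDisc` and neatening `isSmoothlySlice_of_isProperDisc_holds`, all proved in
  `HomotopyBallSliceProofs.lean`); hence `Knot.eq_zero_of_isProjectiveTower_zero_of_eq_zero_of_isSmoothlySlice`:
  GIVEN Rasmussen's `eq_zero_of_isSmoothlySlice`, the height-`0` instances of the fact hold (with `s = 0`).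
* `Knot.rasmussen_nonpos_of_isTowerSlice.eq_zero_of_isSmoothlySlice` — **the fact contains Rasmussen's
  slice theorem**: it implies the named fact `eq_zero_of_isSmoothlySlice` (`s(K) = 0` for smoothly slice
  `K`; Rasmussen 2010, Thm. 1 = MMSW Thm. 6.14 for knots): apply the fact at height `0` to `K` and to
  `K.mirror` (sliceness is mirror-closed, `g₄(K̄) = g₄(K)` and `g₄ = 0 ↔` slice; `s(K̄) = -s(K)`,
  `HasRasmussenInvariant.mirror_holds`). So at height `0` the fact and Rasmussen's theorem are the same
  statement in the tree, and no proof of the fact can avoid the Lee-homology cobordism maps; what the fact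
  adds lies at heights `t ≥ 1`.
* `Knot.rasmussen_nonpos_of_isTowerSlice_iff_nonneg`, `Knot.rasmussen_nonpos_of_isTowerSlice_iff_both` —
  **the `∃ o` renders both printed chiralities**: the fact is equivalent to "for SOME orientation `o'` of
  `ℂℙ²`, every knot tower-slice over `o'` has all its Rasmussen invariants `≥ 0`" (`o' = -o`; Cor. 6.13 for
  `#ᵗℂℙ²bar` versus its mirror statement for `#ᵗℂℙ²`), and to the conjunction of both for one `o`.

## References

* C. Manolescu, M. Marengon, S. Sarkar, M. Willis, Duke Math. J. 172 (2023), Cor. 1.9, Def. 6.2,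
  Remark 6.6, Thm. 6.10, Cor. 6.13, Thm. 6.14 [ManolescuMarengonSarkarWillis2023].
* J. Rasmussen, *Khovanov homology and the slice genus*, Invent. Math. 182 (2010), Thm. 1, §3.5
  [Rasmussen2010].
* C. Manolescu, L. Piccirillo, J. Lond. Math. Soc. 108 (2023), Def. 2.1 [ManolescuPiccirillo2023].
* R. Palais, *Extending diffeomorphisms*, Proc. AMS 11 (1960), Thm. B [Palais1960].
* A. Hatcher, *Algebraic Topology*, CUP (2002), Cor. 2.14 [HatcherAT2002].
* C. Livingston, *A survey of classical knot concordance*, Handbook of Knot Theory (2005), §2 [Livingston2005].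
* J. Cerf, *Sur les difféomorphismes de la sphère de dimension trois (Γ₄ = 0)*, LNM 53 (1968), Ch. I §1,
  Lemme 2 [CerfDiffeoSphere1968].
* M. W. Hirsch, *Differential Topology*, GTM 33 (1976), §4.4 and Ch. 8 §1 [HirschDT1976].
-/

noncomputable section

open scoped Manifold ContDiff Topology
open Set Function CategoryTheory Limits
open Literature.AlgebraicTopology.SingularHomology

namespace Literature.Topology.FourManifolds

/-! ### The reflection `ρ` of `ℝⁿ⁺¹` in the last coordinate has determinant `-1` -/

/-- In the standard basis, the coordinate reflection `reflectLastCLM n` of `ℝⁿ⁺¹` is the diagonal matrix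
`diag(1, …, 1, -1)`. [folklore] -/
theorem toMatrix_reflectLastCLM (n : ℕ) :
    LinearMap.toMatrix (EuclideanSpace.basisFun (Fin (n + 1)) ℝ).toBasis
        (EuclideanSpace.basisFun (Fin (n + 1)) ℝ).toBasis
        ((reflectLastCLM n : EuclideanSpace ℝ (Fin (n + 1)) →L[ℝ] EuclideanSpace ℝ (Fin (n + 1))) :
          EuclideanSpace ℝ (Fin (n + 1)) →ₗ[ℝ] EuclideanSpace ℝ (Fin (n + 1))) =
      Matrix.diagonal fun i => if i = Fin.last n then (-1 : ℝ) else 1 := by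
  ext i j
  rw [LinearMap.toMatrix_apply, Matrix.diagonal_apply, OrthonormalBasis.coe_toBasis_repr_apply,
    EuclideanSpace.basisFun_repr, OrthonormalBasis.coe_toBasis, EuclideanSpace.basisFun_apply,
    ContinuousLinearMap.coe_coe]
  by_cases hij : i = j
  · subst hij
    by_cases hi : i = Fin.last n <;> simp [reflectLastCLM, hi]
  · by_cases hi : i = Fin.last n
    · subst hi
      simp [reflectLastCLM, hij]
    · simp [reflectLastCLM, hi, hij]

/-- **`det ρ = -1`** for the coordinate reflection `ρ = reflectLastCLM n : (x₀, …, xₙ) ↦ (x₀, …, -xₙ)` of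
`ℝⁿ⁺¹` (product of the diagonal entries `1, …, 1, -1`). [folklore] -/
theorem det_reflectLastCLM (n : ℕ) :
    LinearMap.det ((reflectLastCLM n : EuclideanSpace ℝ (Fin (n + 1)) →L[ℝ] EuclideanSpace ℝ (Fin (n + 1))) :
      EuclideanSpace ℝ (Fin (n + 1)) →ₗ[ℝ] EuclideanSpace ℝ (Fin (n + 1))) = -1 := by
  rw [← LinearMap.det_toMatrix (EuclideanSpace.basisFun (Fin (n + 1)) ℝ).toBasis,
    toMatrix_reflectLastCLM, Matrix.det_diagonal, Finset.prod_ite_eq']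
  simp

namespace Knot

/-! ### Chirality: tower-slice over `o` versus the mirror over `-o` -/

/-- **Chirality flip for tower-sliceness** (tree form of MMSW Remark 6.6, *"`L` is strongly H-slice in
`ℂℙ²bar` if and only if `L̄` is strongly slice in `ℂℙ²`"*): if `K` is tower-slice over the orientation `o`
of `ℂℙ²`, then `K.mirror` is tower-slice over `-o`. Same tower `P` with the opposite orientation `-oP`
(an `o`-tower reversed is a `(-o)`-tower, `IsProjectiveTower.neg`), same disc `f`, same open `U` with
`H₂(U; ℤ) = 0`; the ball chart becomes the reflected chart `e ∘ ρ`, `ρ = reflectLastCLM 3`, with respect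
to which the disc bounds `K.mirror` (`Knot.IsSliceDiscIn.mirror`), and `e ∘ ρ` is orientation preserving
from the standard `ℝ⁴` to `(P, -oP)` because `e` is so to `(P, oP)` and `det ρ = -1 < 0`
(`isOrientationReversing_disc_comp_linear_of_det_neg`).
[cite: ManolescuMarengonSarkarWillis2023, §6.1, Remark 6.6] -/
theorem IsTowerSlice.mirror_neg {o : SmoothOrientation (𝓡 4) ComplexProjectivePlane} {K : Knot}
    (h : K.IsTowerSlice o) : K.mirror.IsTowerSlice (-o) := by
  obtain ⟨t, P, _, _, _, _, _, _, oP, e, f, hT, hef, he, U, heU, hfU, hU⟩ := h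
  refine ⟨t, P, _, ‹_›, ‹_›, _, ‹_›, ‹_›, -oP, e ∘ reflectLastCLM 3, f,
    IsProjectiveTower.neg o t P oP hT, hef.mirror, ?_, U, fun v => heU _, hfU, hU⟩
  -- the reflected ball chart is orientation preserving towards `-oP`
  let R : EuclideanSpace ℝ (Fin 4) ≃L[ℝ] EuclideanSpace ℝ (Fin 4) :=
    ContinuousLinearEquiv.equivOfInverse (reflectLastCLM 3) (reflectLastCLM 3)
      (reflectLastCLM_reflectLastCLM 3) (reflectLastCLM_reflectLastCLM 3)
  have hRdet :
      LinearMap.det (R.toLinearEquiv : EuclideanSpace ℝ (Fin 4) →ₗ[ℝ] EuclideanSpace ℝ (Fin 4)) < 0 := by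
    have hR : (R.toLinearEquiv : EuclideanSpace ℝ (Fin 4) →ₗ[ℝ] EuclideanSpace ℝ (Fin 4)) =
        ((reflectLastCLM 3 : EuclideanSpace ℝ (Fin 4) →L[ℝ] EuclideanSpace ℝ (Fin 4)) :
          EuclideanSpace ℝ (Fin 4) →ₗ[ℝ] EuclideanSpace ℝ (Fin 4)) := rfl
    rw [hR, det_reflectLastCLM]
    norm_num
  have he' : IsOrientationReversing (SmoothOrientation.modelSpace (-euclideanOrientation 4)) oP e := by
    rw [isOrientationReversing_iff, ← SmoothOrientation.neg_modelSpace,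
      isOrientationPreserving_neg_neg_iff]
    exact he
  exact isOrientationReversing_disc_comp_linear_of_det_neg hef.isSmoothEmbedding he' R hRdet

/-- **`K.mirror` is tower-slice over `-o` iff `K` is tower-slice over `o`** (the flip applied twice,
`K.mirror.mirror = K`). [cite: ManolescuMarengonSarkarWillis2023, §6.1, Remark 6.6] -/
theorem isTowerSlice_mirror_neg_iff (o : SmoothOrientation (𝓡 4) ComplexProjectivePlane) (K : Knot) :
    K.mirror.IsTowerSlice (-o) ↔ K.IsTowerSlice o := by
  refine ⟨fun h => ?_, IsTowerSlice.mirror_neg⟩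
  have h' : K.mirror.mirror.IsTowerSlice (- -o) := h.mirror_neg
  rwa [neg_neg, show K.mirror.mirror = K from SphereEmbedding.mirror_mirror K] at h'

/-! ### Tower-sliceness is a property of the knot type -/

/-- **Transport of slice-disc data along a diffeotopy of `S³`** by reparametrising the BALL (not the
disc): if `f|_{𝔻²}` is a proper slice disc for `K` in `X ∖ e(B̊⁴)` and `D` is a diffeotopy of `S³`
with `D₁ ∘ K = K'`, then the same disc `f` is a proper slice disc for `K'` with respect to the ball chart
`e ∘ Ψ`, `Ψ = (D.radialExtension)⁻¹` the inverse of the radial extension `x ↦ ‖x‖ · D_{‖x‖}(x/‖x‖)` of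
`D` to `ℝ⁴` (`RadialExtension.lean`; Cerf 1968, Ch. I §1, Lemme 2): `Ψ` is a diffeomorphism of `ℝ⁴`
preserving the norm, so `e ∘ Ψ` is a smooth embedding with `(e ∘ Ψ)(𝔻⁴) = e(𝔻⁴)`, and on `S³` it is
`D₁⁻¹`, so `(e ∘ Ψ) ∘ K' = e ∘ D₁⁻¹ ∘ D₁ ∘ K = e ∘ K = f|_{S¹}`. (Compare
`IsSliceDisc.isProperDisc_radialExtensionFun_comp`, which moves the disc instead, inside `B⁴`.)
[cite: Livingston2005, §2.1] [cite: CerfDiffeoSphere1968, Ch. I §1, Lemme 2] -/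
theorem IsSliceDiscIn.comp_radialExtension_symm {K K' : Knot} {X : Type*} [TopologicalSpace X]
    [ChartedSpace (EuclideanSpace ℝ (Fin 4)) X] {e : EuclideanSpace ℝ (Fin 4) → X}
    {f : EuclideanSpace ℝ (Fin 2) → X} (h : K.IsSliceDiscIn X e f)
    (D : Diffeotopy (𝓡 3) (Metric.sphere (0 : EuclideanSpace ℝ (Fin 4)) 1)) (hD : D.toFun 1 ∘ ⇑K = ⇑K') :
    K'.IsSliceDiscIn X (e ∘ D.radialExtension.symm) f := by
  obtain ⟨he, hf, hinj, hmf, hproper, hbdry⟩ := h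
  refine ⟨he.comp_diffeomorph D.radialExtension.symm, hf, hinj, hmf, ?_, ?_⟩
  · -- properness: `(e ∘ Ψ)(𝔻⁴) ⊆ e(𝔻⁴)` as `Ψ` preserves the norm
    rintro x hx ⟨y, hy, hxy⟩
    refine hproper x hx ⟨D.radialExtension.symm y, ?_, hxy⟩
    rw [mem_closedBall_zero_iff] at hy ⊢
    rwa [Diffeotopy.coe_radialExtension_symm, norm_radialExtensionFun]
  · -- boundary values: `Ψ (K' x) = D₁⁻¹ (D₁ (K x)) = K x`
    intro x
    have hx : K' x = D.toFun 1 (K x) := (congrFun hD x).symm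
    rw [hbdry x, Function.comp_apply, hx, Diffeotopy.coe_radialExtension_symm,
      radialExtensionFun_coe_sphere, D.invFun_toFun]

/-- **The reparametrised ball chart keeps its orientation behaviour.** With `Ψ = (D.radialExtension)⁻¹`
as above, if the disc `e : ℝ⁴ → X` preserves the orientations `(standard, oX)` then so does `e ∘ Ψ`:
`Ψ` is the identity near the origin (`radialExtensionFun_of_norm_le`), so `e ∘ Ψ` and `e` have the same
value and the same differential at `0`; a disc either preserves or reverses two given orientations
(`isOrientationPreserving_or_isOrientationReversing_disc`, Hirsch 1976 §4.4), and "reverses" is refuted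
at `0`, where `det (de)₀ ≠ 0` (`det_mfderiv_ne_zero_of_isSmoothEmbedding`) and a fibre has exactly two
orientations. [cite: HirschDT1976, §4.4 p. 101] -/
theorem isOrientationPreserving_comp_radialExtension_symm {X : Type*} [TopologicalSpace X]
    [ChartedSpace (EuclideanSpace ℝ (Fin 4)) X] [IsManifold (𝓡 4) ∞ X]
    {oX : SmoothOrientation (𝓡 4) X} {e : EuclideanSpace ℝ (Fin 4) → X}
    (hemb : Manifold.IsSmoothEmbedding (𝓡 4) (𝓡 4) ∞ e)
    (he : IsOrientationPreserving (SmoothOrientation.euclidean 4) oX e)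
    (D : Diffeotopy (𝓡 3) (Metric.sphere (0 : EuclideanSpace ℝ (Fin 4)) 1)) :
    IsOrientationPreserving (SmoothOrientation.euclidean 4) oX (e ∘ D.radialExtension.symm) := by
  have hemb' : Manifold.IsSmoothEmbedding (𝓡 4) (𝓡 4) ∞ (e ∘ D.radialExtension.symm) :=
    hemb.comp_diffeomorph D.radialExtension.symm
  -- the reparametrised chart agrees with `e` near the origin
  have hloc : (e ∘ D.radialExtension.symm) =ᶠ[𝓝 0] e := by
    filter_upwards [Metric.closedBall_mem_nhds (0 : EuclideanSpace ℝ (Fin 4))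
      (by norm_num : (0 : ℝ) < 1 / 4)] with y hy
    rw [Function.comp_apply, Diffeotopy.coe_radialExtension_symm,
      radialExtensionFun_of_norm_le D.invFun_zero (mem_closedBall_zero_iff.1 hy)]
  have h0 : (e ∘ D.radialExtension.symm) 0 = e 0 := hloc.eq_of_nhds
  have hd : mfderiv (𝓡 4) (𝓡 4) (e ∘ D.radialExtension.symm) 0 = mfderiv (𝓡 4) (𝓡 4) e 0 :=
    hloc.mfderiv_eq
  rcases isOrientationPreserving_or_isOrientationReversing_disc hemb' (isOpenMap_disc hemb').isOpen_range
      (euclideanOrientation 4) oX with h | h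
  · exact h
  · exfalso
    have h1 := he 0
    have h2 := h 0
    rw [h0, hd] at h2
    simp only [SmoothOrientation.euclidean_apply, SmoothOrientation.modelSpace_apply,
      SmoothOrientation.neg_apply] at h1 h2
    have hdet := det_mfderiv_ne_zero_of_isSmoothEmbedding hemb (isOpenMap_disc hemb).isOpen_range 0
    rcases hdet.lt_or_gt with hneg | hpos
    · rcases orientation_eq_or_eq_neg_of_det_ne_one (hneg.trans one_pos).ne (oX (e 0))
          (euclideanOrientation 4) with h3 | h3
      · exact absurd (h1.1 h3) (not_lt.2 hneg.le)
      · exact absurd (h2.1 (by rw [h3]; exact _root_.neg_neg (euclideanOrientation 4))) (not_lt.2 hneg.le)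
    · exact Module.Ray.ne_neg_self (oX (e 0)) ((h1.2 hpos).trans (h2.2 hpos).symm)

/-- **Tower-sliceness over `o` is a property of the knot type.** If `K ≅ K'` (ambient isotopy of `S³`)
and `K` is tower-slice over `o`, so is `K'`: same tower, same orientation `oP`, same disc, same `U`; the
ball chart is reparametrised by the inverse radial extension of a diffeotopy realising the isotopy
(`AmbientIsotopy.exists_diffeotopy_toFun_eq_invFun_eq`, Hirsch 1976, Ch. 8 §1;
`IsSliceDiscIn.comp_radialExtension_symm`), which keeps it orientation preserving
(`isOrientationPreserving_comp_radialExtension_symm`) and inside `U`. This is the step of the printed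
proof that lets one work with any representative of the knot type — in the tree, with a knot carrying
the Gauss diagram read by `Knot.HasRasmussenInvariant`. [cite: Livingston2005, §2.1]
[cite: ManolescuMarengonSarkarWillis2023, Def. 6.2] -/
theorem IsTowerSlice.of_isIsotopic {o : SmoothOrientation (𝓡 4) ComplexProjectivePlane} {K K' : Knot}
    (hKK' : K.IsIsotopic K') (h : K.IsTowerSlice o) : K'.IsTowerSlice o := by
  obtain ⟨F, hF⟩ := hKK'
  obtain ⟨D, hD, -⟩ := F.exists_diffeotopy_toFun_eq_invFun_eq
  have hD1 : D.toFun 1 ∘ ⇑K = ⇑K' := by rw [hD]; exact hF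
  obtain ⟨t, P, _, _, _, _, _, _, oP, e, f, hT, hef, he, U, heU, hfU, hU⟩ := h
  exact ⟨t, P, _, ‹_›, ‹_›, _, ‹_›, ‹_›, oP, e ∘ D.radialExtension.symm, f, hT,
    hef.comp_radialExtension_symm D hD1,
    isOrientationPreserving_comp_radialExtension_symm hef.isSmoothEmbedding he D, U,
    fun v => heU _, hfU, hU⟩

/-- Isotopic knots are tower-slice over the same orientations (`iff` form; symmetry of isotopy is the
tree's `SphereEmbedding.IsotopyFacts.symm`). [cite: Livingston2005, §2.1] -/
theorem isTowerSlice_congr {o : SmoothOrientation (𝓡 4) ComplexProjectivePlane} {K K' : Knot}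
    (hKK' : K.IsIsotopic K') : K.IsTowerSlice o ↔ K'.IsTowerSlice o :=
  ⟨fun h => h.of_isIsotopic hKK', fun h => h.of_isIsotopic (SphereEmbedding.IsotopyFacts.symm hKK')⟩

/-! ### Height `0`: smoothly slice knots are tower-slice over both orientations -/

/-- `H₂(S⁴; ℤ) = 0`, on the open subset `⊤` of `S⁴` (the shape in which `Knot.IsTowerSlice` asks for it):
`⊤ ≃ₜ S⁴` and `H₂(S⁴; ℤ) = 0` (Hatcher 2002, Cor. 2.14; tree theorem `isZero_singularHomology_sphere_holds`).
[cite: HatcherAT2002, Cor. 2.14] -/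
theorem isZero_singularHomologyZ_two_sphere_four_top :
    IsZero (singularHomologyZ
      (↥(⊤ : TopologicalSpace.Opens (Metric.sphere (0 : EuclideanSpace ℝ (Fin 5)) 1))) 2) := by
  change IsZero (singularHomology ℤ ℤ
    (↥(⊤ : TopologicalSpace.Opens (Metric.sphere (0 : EuclideanSpace ℝ (Fin 5)) 1))) 2)
  let Θ : (Metric.sphere (0 : EuclideanSpace ℝ (Fin 5)) 1) ≃ₜ
      ↥(⊤ : TopologicalSpace.Opens (Metric.sphere (0 : EuclideanSpace ℝ (Fin 5)) 1)) :=
    { toFun := fun x => ⟨x, TopologicalSpace.Opens.mem_top x⟩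
      invFun := fun x => x.1
      left_inv := fun _ => rfl
      right_inv := fun _ => rfl
      continuous_toFun := continuous_id.subtype_mk _
      continuous_invFun := continuous_subtype_val }
  exact (singularHomology.isZero_iff_of_homeomorph ℤ ℤ Θ 2).1
    (isZero_singularHomology_sphere_holds ℤ ℤ (n := 4) (k := 2) (by norm_num) (by norm_num))

/-- **Every smoothly slice knot is tower-slice, at height `0`, over every orientation `o` of `ℂℙ²`.**
A slice disc `g` for `K` in `B⁴` becomes a proper slice disc in `S⁴ ∖ c⁻¹(B̊⁴)` for the round ball
`c⁻¹ = (chartAt a)⁻¹ : ℝ⁴ → S⁴` of the stereographic chart at `a` (`Knot.IsSliceDisc.isSliceDiscIn_sphere`;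
"if a knot is slice in the usual sense, then it is H-slice in any `W`"); `S⁴` (a tower of height `0`,
`isProjectiveTower_zero_sphere`) carries an orientation for which the disc `c⁻¹` is orientation preserving
(`exists_smoothOrientation_sphere`; a disc either preserves or reverses a given orientation,
`isOrientationPreserving_or_isOrientationReversing_disc`, and in the second case one passes to the
opposite orientation); and `U = S⁴` has `H₂ = 0`. In particular the hypothesis of the fact is not vacuous
for either orientation of `ℂℙ²`.
[cite: ManolescuPiccirillo2023, §2 (remark after Def. 2.1)] [cite: ManolescuMarengonSarkarWillis2023, Def. 6.2] -/
theorem IsSmoothlySlice.isTowerSlice {K : Knot} (hK : K.IsSmoothlySlice)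
    (o : SmoothOrientation (𝓡 4) ComplexProjectivePlane) : K.IsTowerSlice o := by
  obtain ⟨g, hg⟩ := hK
  have hS := hg.isSliceDiscIn_sphere ⟨EuclideanSpace.single 0 1, by simp⟩
  have hemb := hS.isSmoothEmbedding
  obtain ⟨oS, -⟩ := exists_smoothOrientation_sphere 4
  obtain ⟨oS', hoS'⟩ : ∃ oS' : SmoothOrientation (𝓡 4) (Metric.sphere (0 : EuclideanSpace ℝ (Fin 5)) 1),
      IsOrientationPreserving (SmoothOrientation.euclidean 4) oS'
        (chartAt (EuclideanSpace ℝ (Fin 4))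
          (⟨EuclideanSpace.single 0 1, by simp⟩ : (Metric.sphere (0 : EuclideanSpace ℝ (Fin 5)) 1))).symm := by
    rcases isOrientationPreserving_or_isOrientationReversing_disc hemb
        (isOpenMap_disc hemb).isOpen_range (euclideanOrientation 4) oS with h | h
    · exact ⟨oS, h⟩
    · exact ⟨-oS, h⟩
  exact ⟨0, (Metric.sphere (0 : EuclideanSpace ℝ (Fin 5)) 1), _, inferInstance, inferInstance, _, inferInstance,
    inferInstance, oS', _, _,
    isProjectiveTower_zero_sphere o oS', hS, hoS', ⊤, fun _ => trivial, fun _ => trivial,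
    isZero_singularHomologyZ_two_sphere_four_top⟩

/-! ### Height `0` is Rasmussen's slice theorem -/

/-- **A knot bounding a proper smooth disc off a ball in a smooth 4-manifold diffeomorphic to `S⁴` is
smoothly slice** (Literature-side assembly of three tree theorems: transport the data to `S⁴`
(`IsSliceDiscIn.diffeomorph_comp`), Palais' disc theorem in the form "the complement of a smooth open
ball of `S⁴` is a smooth ball with the same boundary sphere" (`palais_ballComplement_sphere_four_holds`),
pull the disc back to a proper disc in `B⁴` (`IsSliceDiscIn.exists_isProperDisc`) and neaten it
(`isSmoothlySlice_of_isProperDisc_holds`)). [cite: Palais1960, Thm. B] [cite: FreedmanGompfMorrisonWalker2010, §1] -/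
theorem IsSliceDiscIn.isSmoothlySlice_of_diffeomorph_sphere {K : Knot} {M : Type} [TopologicalSpace M]
    [ChartedSpace (EuclideanSpace ℝ (Fin 4)) M] [IsManifold (𝓡 4) ∞ M] {e : EuclideanSpace ℝ (Fin 4) → M}
    {f : EuclideanSpace ℝ (Fin 2) → M} (h : K.IsSliceDiscIn M e f)
    (φ : M ≃ₘ⟮𝓡 4, 𝓡 4⟯ (Metric.sphere (0 : EuclideanSpace ℝ (Fin 5)) 1)) : K.IsSmoothlySlice := by
  have h' := h.diffeomorph_comp φ
  obtain ⟨U, c, hc₁, hc₂⟩ := palais_ballComplement_sphere_four_holds (φ ∘ e) h'.isSmoothEmbedding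
  obtain ⟨g, hg⟩ := h'.exists_isProperDisc c hc₁ hc₂
  exact isSmoothlySlice_of_isProperDisc_holds K g hg

/-- **Tower-slice data of height `0` make the knot smoothly slice**: a tower of height `0` is a manifold
diffeomorphic to `S⁴` (`isProjectiveTower_zero_iff`), whatever the orientations and the ball chart.
[cite: ManolescuMarengonSarkarWillis2023, §6 (t = 0)] [cite: Palais1960, Thm. B] -/
theorem IsSliceDiscIn.isSmoothlySlice_of_isProjectiveTower_zero
    {o : SmoothOrientation (𝓡 4) ComplexProjectivePlane} {P : Type} [TopologicalSpace P] [T2Space P]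
    [SecondCountableTopology P] [ChartedSpace (EuclideanSpace ℝ (Fin 4)) P] [IsManifold (𝓡 4) ∞ P]
    [CompactSpace P] {oP : SmoothOrientation (𝓡 4) P} {K : Knot} {e : EuclideanSpace ℝ (Fin 4) → P}
    {f : EuclideanSpace ℝ (Fin 2) → P}
    (h : K.IsSliceDiscIn P e f) (hT : IsProjectiveTower o 0 P oP) : K.IsSmoothlySlice :=
  h.isSmoothlySlice_of_diffeomorph_sphere hT.some

/-- **At height `0` the fact IS Rasmussen's slice theorem (converse containment).** GIVEN Rasmussen's
`eq_zero_of_isSmoothlySlice` (`s = 0` for smoothly slice knots; Rasmussen 2010, Thm. 1), every knot with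
tower-slice data of height `0` — over either orientation of `ℂℙ²`, with any ball chart — has all its
Rasmussen invariants `0`, in particular `≤ 0`: the data make the knot smoothly slice
(`IsSliceDiscIn.isSmoothlySlice_of_isProjectiveTower_zero`). Together with
`rasmussen_nonpos_of_isTowerSlice.eq_zero_of_isSmoothlySlice` below: the height-`0` layer of MMSW Cor. 1.9
(knot case) and Rasmussen's theorem are the same statement in the tree; everything the fact adds lies at
heights `t ≥ 1` (`#ᵗℂℙ²bar`, `t ≥ 1`), where the printed proof needs the `s`-invariant of the links
`F_p(1)`. [cite: ManolescuMarengonSarkarWillis2023, Cor. 1.9 and Thm. 6.14] [cite: Rasmussen2010, Thm. 1] -/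
theorem eq_zero_of_isProjectiveTower_zero_of_eq_zero_of_isSmoothlySlice (h0 : eq_zero_of_isSmoothlySlice)
    {o : SmoothOrientation (𝓡 4) ComplexProjectivePlane} {P : Type} [TopologicalSpace P] [T2Space P]
    [SecondCountableTopology P] [ChartedSpace (EuclideanSpace ℝ (Fin 4)) P] [IsManifold (𝓡 4) ∞ P]
    [CompactSpace P] {oP : SmoothOrientation (𝓡 4) P} {K : Knot} {e : EuclideanSpace ℝ (Fin 4) → P}
    {f : EuclideanSpace ℝ (Fin 2) → P}
    (h : K.IsSliceDiscIn P e f) (hT : IsProjectiveTower o 0 P oP) {s : ℤ} (hs : K.HasRasmussenInvariant s) :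
    s = 0 :=
  h0 hs (h.isSmoothlySlice_of_isProjectiveTower_zero hT)

/-! ### The fact contains Rasmussen's slice theorem -/

/-- **MMSW Cor. 1.9 (knot case, tower form) contains Rasmussen's theorem `s(slice knot) = 0`.** GIVEN the
named fact `Knot.rasmussen_nonpos_of_isTowerSlice`, every smoothly slice knot has all its Rasmussen
invariants `0`, i.e. the named fact `Literature.Topology.FourManifolds.eq_zero_of_isSmoothlySlice`
(Rasmussen 2010, Thm. 1; MMSW 2023, Thm. 6.14 for `|L| = 1`) holds: with `o` the orientation provided by
the fact, a slice `K` and its (slice) mirror `K.mirror` are both tower-slice over `o` at height `0`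
(`IsSmoothlySlice.isTowerSlice`), so `s ≤ 0` and, as `s(K̄) = -s(K)` (`HasRasmussenInvariant.mirror_holds`),
`-s ≤ 0`. This is the source's own remark that at `t = 0` the adjunction inequality is the slice-genus
bound, and it records formally that discharging the fact entails discharging Rasmussen's theorem (whose
missing ingredient in the tree — the maps induced on Lee homology by link cobordisms — is also the core of
the printed proof of Cor. 1.9).
[cite: ManolescuMarengonSarkarWillis2023, Cor. 1.9 and Thm. 6.14] [cite: Rasmussen2010, Thm. 1] -/
theorem rasmussen_nonpos_of_isTowerSlice.eq_zero_of_isSmoothlySlice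
    (h : Knot.rasmussen_nonpos_of_isTowerSlice) : eq_zero_of_isSmoothlySlice := by
  obtain ⟨o, ho⟩ := h
  intro K s hs hK
  have h₁ : s ≤ 0 := ho K (hK.isTowerSlice o) s hs
  -- sliceness is mirror-closed: `g₄(K̄) = g₄(K)` and `g₄ = 0 ↔ slice`
  have hKm : K.mirror.IsSmoothlySlice := by
    rw [← Knot.sliceGenus_eq_zero_iff_holds] at hK ⊢
    rwa [Knot.sliceGenus_mirror_holds K]
  have h₂ : -s ≤ 0 :=
    ho K.mirror (hKm.isTowerSlice o) (-s)
      (_root_.Literature.Topology.FourManifolds.HasRasmussenInvariant.mirror_holds hs)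
  omega

/-! ### The two chiralities of the statement -/

/-- **The `∃ o` form renders both printed chiralities.** The named fact (for SOME orientation `o` of `ℂℙ²`,
tower-slice over `o` ⇒ `s ≤ 0`; Cor. 6.13 for `#ᵗℂℙ²bar`) is equivalent to its mirror image (for SOME
orientation `o'`, tower-slice over `o'` ⇒ `s ≥ 0`; the statement for `#ᵗℂℙ²`), via `o' = -o`, the
chirality flip `IsTowerSlice.mirror_neg` and `s(K̄) = -s(K)` (`HasRasmussenInvariant.mirror_holds`) —
Remark 6.6 of the source. [cite: ManolescuMarengonSarkarWillis2023, Cor. 6.13 and Remark 6.6] -/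
theorem rasmussen_nonpos_of_isTowerSlice_iff_nonneg :
    Knot.rasmussen_nonpos_of_isTowerSlice ↔
      ∃ o : SmoothOrientation (𝓡 4) ComplexProjectivePlane, ∀ K : Knot, K.IsTowerSlice o →
        ∀ s : ℤ, K.HasRasmussenInvariant s → 0 ≤ s := by
  constructor
  · rintro ⟨o, h⟩
    refine ⟨-o, fun K hK s hs => ?_⟩
    have := h K.mirror (by simpa using hK.mirror_neg) (-s)
      (_root_.Literature.Topology.FourManifolds.HasRasmussenInvariant.mirror_holds hs)
    omega
  · rintro ⟨o, h⟩
    refine ⟨-o, fun K hK s hs => ?_⟩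
    have := h K.mirror (by simpa using hK.mirror_neg) (-s)
      (_root_.Literature.Topology.FourManifolds.HasRasmussenInvariant.mirror_holds hs)
    omega

/-- **Equivalently, for the fact's orientation `o`: tower-slice over `o` ⇒ `s ≤ 0` AND tower-slice over
`-o` ⇒ `s ≥ 0`** — the pair (Cor. 6.13 for `#ᵗℂℙ²bar`, its mirror for `#ᵗℂℙ²`) for one and the same `o`.
[cite: ManolescuMarengonSarkarWillis2023, Cor. 6.13 and Remark 6.6] -/
theorem rasmussen_nonpos_of_isTowerSlice_iff_both :
    Knot.rasmussen_nonpos_of_isTowerSlice ↔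
      ∃ o : SmoothOrientation (𝓡 4) ComplexProjectivePlane,
        (∀ K : Knot, K.IsTowerSlice o → ∀ s : ℤ, K.HasRasmussenInvariant s → s ≤ 0) ∧
        (∀ K : Knot, K.IsTowerSlice (-o) → ∀ s : ℤ, K.HasRasmussenInvariant s → 0 ≤ s) := by
  constructor
  · rintro ⟨o, h⟩
    refine ⟨o, h, fun K hK s hs => ?_⟩
    have := h K.mirror (by simpa using hK.mirror_neg) (-s)
      (_root_.Literature.Topology.FourManifolds.HasRasmussenInvariant.mirror_holds hs)
    omega
  · rintro ⟨o, h, -⟩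
    exact ⟨o, h⟩

/-! ### The diagram-level form: the interface the missing Lee-homology layer has to meet -/

/-- **Diagram-level form of the fact.** Because tower-sliceness is a property of the knot type
(`IsTowerSlice.of_isIsotopic`) and `Knot.HasRasmussenInvariant K s` means "some knot isotopic to `K` has a
Gauss diagram `D` with `s(D) = s`", the named fact is EQUIVALENT to the statement about one knot and one
of its own diagrams: for SOME orientation `o` of `ℂℙ²`, every knot `K` tower-slice over `o` and every
Gauss diagram `D` read off a regular projection of `K` (`Knot.HasGaussDiagram K D`) satisfy
`D.rasmussenInvariant ≤ 0`. This is the exact shape in which the printed proof delivers the inequality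
(a filtered chain map on the Lee complex of the diagram `D`, induced by a movie of the cobordism built in
the proof of Thm. 6.10), so it is the interface the tree's future link-level Lee-homology layer has to
meet; no isotopy bookkeeping is left in it. [cite: ManolescuMarengonSarkarWillis2023, Cor. 1.9 and proof of Thm. 6.10]
[cite: Rasmussen2010, Def. 3.4] -/
theorem rasmussen_nonpos_of_isTowerSlice_iff_diagram :
    Knot.rasmussen_nonpos_of_isTowerSlice ↔
      ∃ o : SmoothOrientation (𝓡 4) ComplexProjectivePlane, ∀ (K : Knot) (D : GaussDiagram),
        K.IsTowerSlice o → K.HasGaussDiagram D → D.rasmussenInvariant ≤ 0 := by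
  constructor
  · rintro ⟨o, h⟩
    exact ⟨o, fun K D hK hD => h K hK _ ⟨K, D, SphereEmbedding.IsIsotopic.refl K, hD, rfl⟩⟩
  · rintro ⟨o, h⟩
    refine ⟨o, fun K hK s hs => ?_⟩
    obtain ⟨K', D, hKK', hD, rfl⟩ := hs
    exact h K' D (hK.of_isIsotopic hKK') hD

/-- **Sufficient diagram-level form, one chirality fixed by the user.** To discharge the fact it is
enough to exhibit an orientation `o` of `ℂℙ²` and prove, for every knot `K` with a Gauss diagram `D` and
every tower-slice datum of `K` over `o` with the data spelled out (height `t`, tower `(P, oP)`,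
orientation-preserving ball chart `e`, disc `f`, open `U ⊇ e(ℝ⁴) ∪ f(ℝ²)` with `H₂(U; ℤ) = 0`), that
`D.rasmussenInvariant ≤ 0`. (Unfolding of `rasmussen_nonpos_of_isTowerSlice_iff_diagram`, stated for
direct use by a proof following MMSW §6.) [cite: ManolescuMarengonSarkarWillis2023, Cor. 1.9, Def. 6.2] -/
theorem rasmussen_nonpos_of_isTowerSlice_of_diagram (o : SmoothOrientation (𝓡 4) ComplexProjectivePlane)
    (h : ∀ (K : Knot) (D : GaussDiagram) (t : ℕ) (P : Type) [TopologicalSpace P] [T2Space P]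
      [SecondCountableTopology P] [ChartedSpace (EuclideanSpace ℝ (Fin 4)) P] [IsManifold (𝓡 4) ∞ P]
      [CompactSpace P] (oP : SmoothOrientation (𝓡 4) P) (e : EuclideanSpace ℝ (Fin 4) → P)
      (f : EuclideanSpace ℝ (Fin 2) → P) (U : TopologicalSpace.Opens P),
      K.HasGaussDiagram D → IsProjectiveTower o t P oP → K.IsSliceDiscIn P e f →
      IsOrientationPreserving (SmoothOrientation.euclidean 4) oP e →
      (∀ v, e v ∈ U) → (∀ y, f y ∈ U) → IsZero (singularHomologyZ (↥U) 2) →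
      D.rasmussenInvariant ≤ 0) :
    Knot.rasmussen_nonpos_of_isTowerSlice := by
  refine rasmussen_nonpos_of_isTowerSlice_iff_diagram.2 ⟨o, fun K D hK hD => ?_⟩
  obtain ⟨t, P, _, _, _, _, _, _, oP, e, f, hT, hef, he, U, heU, hfU, hU⟩ := hK
  exact h K D t P oP e f U hD hT hef he heU hfU hU

end Knot

end Literature.Topology.FourManifolds

end
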